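/-
Copyright (c) 2026 the pub-hodgecm-mathlib formalisation cell (harness21).  Prover seat hodgecm-mathlib-K2E3-p12 (g9), programme R90-TF,
section S4 = Rogawski Ch. 13.1–2 (base `R90-C131`), deal S4#C-INV (S4 dealer K2E2-plan (g6), 2026-09-04T16:22Z).
-/
import Literature.NumberTheory.Rogawski1990.LocalTransfer   -- ★ `stableOrbitalIntegralRel`, `stableOrbitalIntegralRel_congr`, `OrbitalMeasureFamily`, `classOrbitalIntegral`
import Literature.NumberTheory.Rogawski1990.Ch4Sec10        -- ★ `epsKappaOrbitalIntegral` (4.10.1), `classEpsOrbitalIntegral`, `epsOrbitalIntegral`, `epsNorm`, `unitaryTwist`, `IsStablyEpsConj`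
import HarnessLib

/-!
# R90-TF · S4 (Ch. 13.1–2) · S4#C-INV — stable (ε-)orbital integrals are CLASS FUNCTIONS of the stable (ε-)class

Cell `hodgecm-mathlib`, crux H413 (`stmt-HodgeConjecture-24833`), route of record `HCCMUnconditional`; programme R90-TF, section S4 =
Rogawski Ch. 13.1–2 (base `R90-C131`), seat K2E3-p12 (g9), deal S4#C-INV of the S4 dealer K2E2-plan (g6).  Lane `--supports
stmt-HodgeConjecture-24833 --as helper`; GENERIC support lemmas (no definition, no instance, no notation, no `sorry`), ★-only imports
`Rogawski1990.LocalTransfer` + `Rogawski1990.Ch4Sec10`.  PURPOSE: the twisted transfer relation «`φ → f`» (4.10.2) compares `Φ^st_ε(δ, φ)` with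
`Φ^st(γ, f)` for `γ ∈ 𝒩(δ)`; both sides must depend on `δ` ∕ `γ` only through the STABLE (ε-)class — this file records exactly that, for the tree's
relation-parametric currencies ★ `stableOrbitalIntegralRel st m f γ = Σᶠ_{[γ′] : st γ (out [γ′])} Φ([γ′], f)` ([Rogawski1990, §4.1 (4.1.1) p. 39]) and ★
`Ch4Sec10.epsKappaOrbitalIntegral ε stε κ e m φ δ = Σᶠ_{c : stε δ (out c)} κ δ c · e (out c) · Φ_ε(out c, φ)` ([§4.10 (4.10.1) p. 57]).

THE (ELEMENTARY) MATHEMATICS.  Both integrals are `finsum`s over the classes `c` selected by the predicate `st γ (out c)` (resp. `stε δ (out c)`);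
hence they depend on `γ` (resp. `δ`) only through the SET `{x | st γ x}` — ★ `stableOrbitalIntegralRel_congr` records this on the `G`-side from an
`↔`.  If `st` is SYMMETRIC and TRANSITIVE (e.g. any pull-back `fun a b => IsConj (ι a) (ι b)` of monoid conjugacy, which is how the tree spells stable
conjugacy: ★ `IsStablyConj`, ★ `Ch4Sec10.IsStablyEpsConj σ Φ δ δ′ := IsConj (N δ) (N δ′)`), then `st γ γ′` gives `{x | st γ x} = {x | st γ′ x}`, so
`Φ^st(γ, f) = Φ^st(γ′, f)`; on the ε-side the same holds for `Φ^κ_ε` provided the weight `κ δ ·` is itself a class function of `δ` (automatic for the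
STABLE case `κ = 1`; the Kottwitz signs `e(δ^ν)` are read at the class representatives and need no hypothesis).
* §1 (`G`-side): `stableOrbitalIntegralRel_eq_of_symm_trans`, `…_eq_of_equivalence`, and the `IsConj`-pull-back instance
  `stableOrbitalIntegralRel_eq_of_isConj_apply` (for ★ `IsStablyConj σ H` itself the statement is ★ `stableOrbitalIntegral_eq_of_isStablyConj` — cited,
  not restated).
* §2 (ε-side, ★ `Ch4Sec10`): sanity `@[simp]` zero lemmas (`Φ_ε(δ, 0) = 0`, `Φ^κ_ε(δ, 0) = 0`); `epsKappaOrbitalIntegral_congr` (from `↔` + equality of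
  the weights); `…_eq_of_symm_trans`; the stable specialisation `κ = 1`: `epsKappaOrbitalIntegral_one_eq_finsum`, `epsStableOrbitalIntegral_eq_of_symm_trans`,
  the pull-back instance `epsStableOrbitalIntegral_eq_of_isConj_apply`, and the unitary instance `epsStableOrbitalIntegral_eq_of_isStablyEpsConj` for ★
  `Ch4Sec10.IsStablyEpsConj σ Φ` with `ε = unitaryTwist σ Φ` (any commutative ring `R` with involution, any `Φ ∈ GL_n(R)`).
NOT typed (dealer: «skip unless free»): additivity `Φ^κ_ε(δ, φ + ψ) = Φ^κ_ε(δ, φ) + Φ^κ_ε(δ, ψ)` — it needs integrability of both twisted integrands on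
every contributing class AND finiteness of `𝒟_ε(δ∕F)` (a `finsum` over an infinite support is `0`); neither is available as a ★ lemma today.

HONEST LABEL: support lemmas — no socket moves by this file; HC_CM is proved only modulo the 7 printed citations (2 remaining named inputs: hLiu418 =
`stmt-HodgeConjecture-24832`, h413 = `stmt-HodgeConjecture-24833`) until rung 0 closes.  REL ≠ ★ ≠ BUILT.

## References
* [Rogawski1990] J. D. Rogawski, *Automorphic Representations of Unitary Groups in Three Variables*, Ann. of Math. Stud. 123 (1990): §4.1 (4.1.1)
  pp. 39–40 («depends only on the stable conjugacy class»), §4.3 p. 43, §4.10 (4.10.1)–(4.10.2) pp. 57–58, §3.11 Prop. 3.11.1 (c) p. 34.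
-/

set_option autoImplicit false
set_option linter.dupNamespace false

noncomputable section

open MeasureTheory
open scoped MatrixGroups
open Literature.NumberTheory.Rogawski1990 Literature.NumberTheory.Automorphic
open Literature.NumberTheory.Rogawski1990.Ch4Sec10

namespace Summit.HodgeConjecture.HodgeConjecture.R90.S4

/-! ## §1 The `G`-side: `Φ^st(γ, f)` is a class function of the stable class (relation-parametric) -/

section GSide

variable {G : Type*} [Group G] [∀ γ : G, MeasurableSpace (G ⧸ Subgroup.centralizer ({γ} : Set G))]

/-- **`Φ^st(γ, f) = Φ^st(γ′, f)` for `st`-related `γ, γ′`** whenever the «stable conjugacy» relation `st` is symmetric and transitive: then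
`st γ γ′` forces `{x | st γ x} = {x | st γ′ x}`, and ★ `stableOrbitalIntegralRel_congr` applies.  [cite: Rogawski1990, §4.1 (4.1.1) p. 40] -/
theorem stableOrbitalIntegralRel_eq_of_symm_trans {st : G → G → Prop} (hsymm : ∀ ⦃x y⦄, st x y → st y x) (htrans : ∀ ⦃x y z⦄, st x y → st y z → st x z)
    {γ γ' : G} (h : st γ γ') (m : OrbitalMeasureFamily G) (f : G → ℂ) :
    stableOrbitalIntegralRel st m f γ = stableOrbitalIntegralRel st m f γ' :=
  stableOrbitalIntegralRel_congr (fun _ => ⟨fun h1 => htrans (hsymm h) h1, fun h1 => htrans h h1⟩) m f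

/-- **`Φ^st(γ, f) = Φ^st(γ′, f)` for `st`-related `γ, γ′`**, `st` an equivalence relation.  [cite: Rogawski1990, §4.1 (4.1.1) p. 40] -/
theorem stableOrbitalIntegralRel_eq_of_equivalence {st : G → G → Prop} (he : Equivalence st)
    {γ γ' : G} (h : st γ γ') (m : OrbitalMeasureFamily G) (f : G → ℂ) :
    stableOrbitalIntegralRel st m f γ = stableOrbitalIntegralRel st m f γ' :=
  stableOrbitalIntegralRel_eq_of_symm_trans (st := st) (fun _ _ h1 => he.symm h1) (fun _ _ _ h1 h2 => he.trans h1 h2) h m f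

/-- **The `IsConj`-pull-back instance**: for ANY map `ι : G → M` into a monoid and `st γ γ′ :↔ IsConj (ι γ) (ι γ′)` (the tree's spelling of stable
conjugacy: `ι` = the inclusion `U(σ, H)(R) ↪ GL_n(R)` gives ★ `IsStablyConj`, for which the statement is ★ `stableOrbitalIntegral_eq_of_isStablyConj`),
`IsConj (ι γ) (ι γ′)` implies `Φ^st(γ, f) = Φ^st(γ′, f)`.  [cite: Rogawski1990, §4.1 (4.1.1) p. 40] -/
theorem stableOrbitalIntegralRel_eq_of_isConj_apply {M : Type*} [Monoid M] (ι : G → M) {γ γ' : G} (h : IsConj (ι γ) (ι γ'))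
    (m : OrbitalMeasureFamily G) (f : G → ℂ) :
    stableOrbitalIntegralRel (fun a b => IsConj (ι a) (ι b)) m f γ =
      stableOrbitalIntegralRel (fun a b => IsConj (ι a) (ι b)) m f γ' :=
  stableOrbitalIntegralRel_eq_of_symm_trans (st := fun a b => IsConj (ι a) (ι b))
    (fun _ _ h1 => h1.symm) (fun _ _ _ h1 h2 => h1.trans h2) h m f

end GSide

/-! ## §2 The ε-side: (4.10.1) `Φ^κ_ε(δ, φ)` is a class function of the stable ε-class (relation-parametric, ★ `Ch4Sec10`) -/

section EpsSide

variable {Gt : Type*} [Group Gt] (ε : Gt →* Gt) {Z' : Subgroup Gt} [∀ δ : Gt, MeasurableSpace (Gt ⧸ epsCentralizer ε δ)]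

/-- Sanity: `Φ_ε(δ, 0) = 0`.  [cite: Rogawski1990, §1.6 pp. 5–6] -/
@[simp] theorem epsOrbitalIntegral_zero_fun {E : Type*} [NormedAddCommGroup E] [NormedSpace ℝ E] (δ : Gt)
    (m : Measure (Gt ⧸ epsCentralizer ε δ)) : epsOrbitalIntegral ε δ (0 : Gt → E) m = 0 := by
  simp only [epsOrbitalIntegral, descEpsConj, Pi.zero_apply, integral_zero]

/-- Sanity: `Φ_ε(δ_c, 0) = 0` at every ε-class `c`.  [cite: Rogawski1990, §4.10 (4.10.1) p. 57] -/
@[simp] theorem classEpsOrbitalIntegral_zero_fun {E : Type*} [NormedAddCommGroup E] [NormedSpace ℝ E]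
    (m : EpsOrbitalMeasureFamily ε Z') (c : EpsConjClassesMod ε Z') : classEpsOrbitalIntegral ε m (0 : Gt → E) c = 0 := by
  simp only [classEpsOrbitalIntegral, epsOrbitalIntegral_zero_fun]

/-- Sanity: `Φ^κ_ε(δ, 0) = 0`.  [cite: Rogawski1990, §4.10 (4.10.1) p. 57] -/
@[simp] theorem epsKappaOrbitalIntegral_zero_fun (stε : Gt → Gt → Prop) (κ : Gt → EpsConjClassesMod ε Z' → ℂ) (e : Gt → ℂ)
    (m : EpsOrbitalMeasureFamily ε Z') (δ : Gt) : epsKappaOrbitalIntegral ε stε κ e m (0 : Gt → ℂ) δ = 0 := by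
  simp only [epsKappaOrbitalIntegral, classEpsOrbitalIntegral_zero_fun, mul_zero, finsum_zero]

/-- **`Φ^κ_ε` depends on `δ` only through `{x | stε δ x}` and the weights `κ δ ·`**: if `stε δ = stε δ′` (as predicates) and `κ δ = κ δ′` then
`Φ^κ_ε(δ, φ) = Φ^κ_ε(δ′, φ)` — the ε-twin of ★ `stableOrbitalIntegralRel_congr`.  [cite: Rogawski1990, §4.10 (4.10.1) p. 57] -/
theorem epsKappaOrbitalIntegral_congr {stε : Gt → Gt → Prop} {κ : Gt → EpsConjClassesMod ε Z' → ℂ} {δ δ' : Gt}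
    (h : ∀ x, stε δ x ↔ stε δ' x) (hκ : ∀ c, κ δ c = κ δ' c) (e : Gt → ℂ) (m : EpsOrbitalMeasureFamily ε Z') (φ : Gt → ℂ) :
    epsKappaOrbitalIntegral ε stε κ e m φ δ = epsKappaOrbitalIntegral ε stε κ e m φ δ' := by
  have hs : {c : EpsConjClassesMod ε Z' | stε δ (Quotient.out c)} = {c : EpsConjClassesMod ε Z' | stε δ' (Quotient.out c)} :=
    Set.ext fun c => h _
  unfold epsKappaOrbitalIntegral
  rw [hs]
  exact finsum_mem_congr rfl fun c _ => by rw [hκ c]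

/-- **`Φ^κ_ε(δ, φ) = Φ^κ_ε(δ′, φ)` for stably ε-conjugate `δ, δ′`** (`stε` symmetric and transitive) when the weight `κ` is a class function of `δ`
(`κ δ = κ δ′`).  [cite: Rogawski1990, §4.10 (4.10.1) p. 57] -/
theorem epsKappaOrbitalIntegral_eq_of_symm_trans {stε : Gt → Gt → Prop} (hsymm : ∀ ⦃x y⦄, stε x y → stε y x) (htrans : ∀ ⦃x y z⦄, stε x y → stε y z → stε x z)
    {κ : Gt → EpsConjClassesMod ε Z' → ℂ} {δ δ' : Gt} (h : stε δ δ') (hκ : ∀ c, κ δ c = κ δ' c)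
    (e : Gt → ℂ) (m : EpsOrbitalMeasureFamily ε Z') (φ : Gt → ℂ) :
    epsKappaOrbitalIntegral ε stε κ e m φ δ = epsKappaOrbitalIntegral ε stε κ e m φ δ' :=
  epsKappaOrbitalIntegral_congr ε (fun _ => ⟨fun h1 => htrans (hsymm h) h1, fun h1 => htrans h h1⟩) hκ e m φ

/-- **The STABLE twisted orbital integral `Φ^st_ε(δ, φ)` is (4.10.1) at `κ = 1`**: `Φ^st_ε(δ, φ) = Σᶠ_{c : stε δ (out c)} e(δ_c) · Φ_ε(δ_c, φ)`
(«If `κ` is trivial, denote `Φ^κ_ε(δ, φ)` by `Φ^st_ε(δ, φ)`»).  [cite: Rogawski1990, §4.10 (4.10.1) p. 57] -/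
theorem epsKappaOrbitalIntegral_one_eq_finsum (stε : Gt → Gt → Prop) (e : Gt → ℂ) (m : EpsOrbitalMeasureFamily ε Z') (φ : Gt → ℂ)
    (δ : Gt) : epsKappaOrbitalIntegral ε stε (fun _ _ => 1) e m φ δ =
      ∑ᶠ c ∈ {c : EpsConjClassesMod ε Z' | stε δ (Quotient.out c)}, e (Quotient.out c) * classEpsOrbitalIntegral ε m φ c := by
  simp only [epsKappaOrbitalIntegral, one_mul]

/-- **`Φ^st_ε(δ, φ) = Φ^st_ε(δ′, φ)` for stably ε-conjugate `δ, δ′`** (`stε` symmetric and transitive; `κ = 1`, any sign function `e` read at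
the class representatives).  [cite: Rogawski1990, §4.10 (4.10.1) p. 57] -/
theorem epsStableOrbitalIntegral_eq_of_symm_trans {stε : Gt → Gt → Prop} (hsymm : ∀ ⦃x y⦄, stε x y → stε y x) (htrans : ∀ ⦃x y z⦄, stε x y → stε y z → stε x z)
    {δ δ' : Gt} (h : stε δ δ') (e : Gt → ℂ) (m : EpsOrbitalMeasureFamily ε Z') (φ : Gt → ℂ) :
    epsKappaOrbitalIntegral ε stε (fun _ _ => 1) e m φ δ = epsKappaOrbitalIntegral ε stε (fun _ _ => 1) e m φ δ' :=
  epsKappaOrbitalIntegral_eq_of_symm_trans ε hsymm htrans h (fun _ => rfl) e m φ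

/-- **The `IsConj`-pull-back instance on the ε-side**: for ANY map `ι : Gt → M` into a monoid and `stε δ δ′ :↔ IsConj (ι δ) (ι δ′)` — e.g.
`ι = N = epsNorm ε` (stable ε-conjugacy read through the norm map, Prop. 3.11.1 (c)) or `ι = j ∘ N` for an embedding `j` — `IsConj (ι δ) (ι δ′)`
implies `Φ^st_ε(δ, φ) = Φ^st_ε(δ′, φ)`.  [cite: Rogawski1990, §4.10 (4.10.1) p. 57] [cite: Rogawski1990, §3.11 Prop. 3.11.1 (c) p. 34] -/
theorem epsStableOrbitalIntegral_eq_of_isConj_apply {M : Type*} [Monoid M] (ι : Gt → M) {δ δ' : Gt} (h : IsConj (ι δ) (ι δ'))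
    (e : Gt → ℂ) (m : EpsOrbitalMeasureFamily ε Z') (φ : Gt → ℂ) :
    epsKappaOrbitalIntegral ε (fun a b => IsConj (ι a) (ι b)) (fun _ _ => 1) e m φ δ =
      epsKappaOrbitalIntegral ε (fun a b => IsConj (ι a) (ι b)) (fun _ _ => 1) e m φ δ' :=
  epsStableOrbitalIntegral_eq_of_symm_trans ε (stε := fun a b => IsConj (ι a) (ι b))
    (fun _ _ h1 => h1.symm) (fun _ _ _ h1 h2 => h1.trans h2) h e m φ

end EpsSide

/-! ### The unitary instance: ★ `Ch4Sec10.IsStablyEpsConj σ Φ` on `G̃ = GL_n(R)` with `ε = unitaryTwist σ Φ` -/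

section Unitary

variable {R : Type*} [CommRing R] [TopologicalSpace R] {n : Type*} [Fintype n] [DecidableEq n] (σ : R →+* R) (Φ : GL n R)
  {Z' : Subgroup (GL n R)} [∀ δ : GL n R, MeasurableSpace (GL n R ⧸ epsCentralizer (unitaryTwist σ Φ) δ)]

/-- **`Φ^st_ε(δ, φ) = Φ^st_ε(δ′, φ)` for STABLY ε-CONJUGATE `δ, δ′ ∈ G̃ = GL_n(R)`** in the tree's currency ★ `Ch4Sec10.IsStablyEpsConj σ Φ δ δ′`
(`:↔ IsConj (N δ) (N δ′)`, `N = epsNorm (unitaryTwist σ Φ)`, Prop. 3.11.1 (c)): the stable twisted orbital integral (4.10.1) at `κ = 1` for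
`ε = unitaryTwist σ Φ`, any sign function `e`, any family `m` of twisted orbital measures, any `φ` — over any commutative ring `R` with an involution
`σ` and any `Φ ∈ GL_n(R)`.  This is what makes the relation «`φ → f`» (4.10.2) well posed on stable ε-classes.
[cite: Rogawski1990, §4.10 (4.10.1)–(4.10.2) pp. 57–58] [cite: Rogawski1990, §3.11 Prop. 3.11.1 (c) p. 34] -/
theorem epsStableOrbitalIntegral_eq_of_isStablyEpsConj {δ δ' : GL n R} (h : IsStablyEpsConj σ Φ δ δ')
    (e : GL n R → ℂ) (m : EpsOrbitalMeasureFamily (unitaryTwist σ Φ) Z') (φ : GL n R → ℂ) :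
    epsKappaOrbitalIntegral (unitaryTwist σ Φ) (IsStablyEpsConj σ Φ) (fun _ _ => 1) e m φ δ =
      epsKappaOrbitalIntegral (unitaryTwist σ Φ) (IsStablyEpsConj σ Φ) (fun _ _ => 1) e m φ δ' :=
  epsStableOrbitalIntegral_eq_of_isConj_apply (unitaryTwist σ Φ) (epsNorm (unitaryTwist σ Φ)) h e m φ

end Unitary

end Summit.HodgeConjecture.HodgeConjecture.R90.S4

end
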